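import Summits.NavierStokesRegularity.FunctionalMining.PlanarShadowWitness
import Summits.NavierStokesRegularity.FunctionalMining.PlanarShadowTopEig
import Summits.NavierStokesRegularity.FunctionalMining.TopEigHeatConvex
import HarnessLib

/-!
# FunctionalMining — the two-mode laminate `u = (F(x₂), 0, 0)`, `F = sin 2πx₂ − (1/27) sin 6πx₂`:
# tables, kinematics, and the planar strain of its whole heat line (laminate calibration, part 1)

Search for candidate a priori estimates; no regularity claim. Cell `pub-nsfunc`, prove seat
(gen 19). One explicit trigonometric field on `T³` and its pointwise kinematics, read off the
COMPUTABLE Fourier tables of `TrigPolyExact` (identities by `decide +kernel`); nothing about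
Navier–Stokes dynamics is asserted. Part 2 (`TopEigLaminateFour`) evaluates the heat dissipation
of `∫(λ₁⁺)⁴` on this field and derives `TopEigHeatCoercive 4 c → c ≤ (2637/2957)·16π² < 16π²`.

THE FIELD. `u(x) = (F(x₂), 0, 0)` with `F(s) = sin 2πs − (1/27) sin 6πs`: component tables
`V = (L0, [], [])`, `L0 = symm (0,0,1) (−i/2) ++ symm (0,0,3) (i/54)`; `u = tabField V`
(`PlanarShadowWitness.tabField`).

PROVED HERE [ours, calibration / bookkeeping]:
* `u` is smooth, divergence free (`isDivFree_u`) and zero-mean (`hasZeroMean_u`);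
  `(∂ᵢu)ⱼ = 2π·evalR (D i (V j))`, `Δu = (2π)²·tabField (lapT ∘ V)` (`laplacian_u`),
  `(∂ᵢΔu)ⱼ = (2π)³·evalR (D i (lapT (V j)))`; all `x₀`-, `x₁`-derivatives and all components
  `j ≠ 0` vanish (the profile depends on `x₂` only);
* `strain_u`, `strain_laplacian_u` — the strains of `u` AND of `Δu` are PLANAR trace-free tensors
  (`PlanarTopEig.IsPlanarTF`: the plane shear `½F′(x₂)(e₀⊗e₂ + e₂⊗e₀)`), with `S₀₀ = 0` and
  `S₀₂ = π·α`, resp. `(2π)²π·β`, where `α = evalR (D 2 L0) = F′/(2π)` and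
  `β = evalR (D 2 (lapT L0)) = F‴/(2π)³`;
* **`lam_pow_four_line`** — along the heat line `u + tΔu` (every real `t`) the strain stays planar,
  so the top-eigenvalue weights are exact fourth powers:
  `λ(S(u + tΔu))⁴ = λ(−S(u + tΔu))⁴ = (π α + t (2π)²π β)⁴` and `λ(±S) ≥ 0`
  (`PlanarTopEig.IsPlanarTF.lam_pow_four`, `TopEig.strainFlat_add_smul`).
-/


noncomputable section

open MeasureTheory Complex UnitAddTorus Set

namespace Summit.NavierStokesRegularity.FunctionalMining

open Literature.Analysis Literature.Analysis.FunctionSpaces Literature.Analysis.FunctionSpaces.Torus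
  Literature.Analysis.FluidPDE
open TrigPolyExact TrigPolyExact.TP TopEig PlanarTopEig PlanarShadow StrainL4

namespace TopEigLaminate

/-! ## 1. The laminate and its tables -/

/-- Table of `F(x₂) = sin 2πx₂ − (1/27) sin 6πx₂`. [ours; bookkeeping] -/
def L0 : TP := symm (0, 0, 1) ⟨0, -1 / 2⟩ ++ symm (0, 0, 3) ⟨0, 1 / 54⟩

/-- Component tables `(L0, [], [])`. [ours; bookkeeping] -/
def V : Fin 3 → TP := ![L0, [], []]

/-- `V 0 = L0`. [ours; bookkeeping] -/
@[simp] theorem V_zero : V 0 = L0 := rfl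
/-- `V 1 = []`. [ours; bookkeeping] -/
@[simp] theorem V_one : V 1 = [] := rfl
/-- `V 2 = []`. [ours; bookkeeping] -/
@[simp] theorem V_two : V 2 = [] := rfl

/-- `L0` is a real table. [ours; bookkeeping] -/
theorem isReal_L0 : IsReal L0 := (isReal_symm _ _).append (isReal_symm _ _)

/-- **The laminate** `u = (F(x₂), 0, 0)`. Search for candidate a priori estimates; no regularity
claim. [ours] -/
def u : UnitAddTorus (Fin 3) → EuclideanSpace ℝ (Fin 3) := tabField V

/-- `u` is smooth. [ours] -/
theorem isSmooth_u : IsSmooth u := isSmooth_tabField V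

/-- `u` is `C¹`. [ours; bookkeeping] -/
theorem isContDiff_u : IsContDiff 1 u := isSmooth_u.isContDiff (by simp)

/-- Velocity gradient in table form: `(∂ᵢu)ⱼ = 2π · evalR (D i (V j))`. [ours] -/
theorem partialDeriv_u (i : Fin 3) (x : UnitAddTorus (Fin 3)) (j : Fin 3) :
    Torus.partialDeriv i u x j = 2 * Real.pi * evalR (TP.D i (V j)) x := by
  rw [u, partialDeriv_tabField]; simp

/-- Second derivatives in table form. [ours] -/
theorem partialDeriv_partialDeriv_u (k i : Fin 3) (x : UnitAddTorus (Fin 3)) (j : Fin 3) :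
    Torus.partialDeriv k (Torus.partialDeriv i u) x j =
      (2 * Real.pi) ^ 2 * evalR (TP.D k (TP.D i (V j))) x := by
  rw [u, partialDeriv_tabField]
  have h : (fun x => (2 * Real.pi) • tabField (fun j => TP.D i (V j)) x) =
      (2 * Real.pi) • tabField (fun j => TP.D i (V j)) := rfl
  rw [h, partialDeriv_const_smul ((isSmooth_tabField _).isContDiff (by simp)), partialDeriv_tabField]
  simp; ring

/-- The profile depends on `x₂` only: `x₀`- and `x₁`-derivatives of `L0` and of `lapT L0` collect to
`[]`. [ours; by `decide`] -/
theorem collect_D_tables :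
    collect (TP.D 0 L0) = [] ∧ collect (TP.D 1 L0) = [] ∧
      collect (TP.D 0 (TP.lapT L0)) = [] ∧ collect (TP.D 1 (TP.lapT L0)) = [] := by
  refine ⟨?_, ?_, ?_, ?_⟩ <;> decide +kernel

/-- `(∂₀u)₀ = 0`. [ours] -/
theorem partialDeriv_zero_u_zero (x : UnitAddTorus (Fin 3)) : Torus.partialDeriv 0 u x 0 = 0 := by
  rw [partialDeriv_u, V_zero, ← evalR_collect, collect_D_tables.1]; simp [evalR]

/-- `(∂₁u)₀ = 0`. [ours] -/
theorem partialDeriv_one_u_zero (x : UnitAddTorus (Fin 3)) : Torus.partialDeriv 1 u x 0 = 0 := by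
  rw [partialDeriv_u, V_zero, ← evalR_collect, collect_D_tables.2.1]; simp [evalR]

/-- `(∂ₖu)₁ = 0`. [ours] -/
theorem partialDeriv_u_one (k : Fin 3) (x : UnitAddTorus (Fin 3)) : Torus.partialDeriv k u x 1 = 0 := by
  rw [partialDeriv_u, V_one]; simp [TP.D, evalR]

/-- `(∂ₖu)₂ = 0`. [ours] -/
theorem partialDeriv_u_two (k : Fin 3) (x : UnitAddTorus (Fin 3)) : Torus.partialDeriv k u x 2 = 0 := by
  rw [partialDeriv_u, V_two]; simp [TP.D, evalR]

/-- **`u` is divergence free.** [ours] -/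
theorem isDivFree_u : IsDivFree u := by
  intro x
  rw [divergence_eq_sum_partialDeriv_apply isContDiff_u, Fin.sum_univ_three, partialDeriv_zero_u_zero,
    partialDeriv_u_one, partialDeriv_u_two]
  ring

/-- Zero modes of the component tables vanish. [ours; by `decide`] -/
theorem coeff0_V (j : Fin 3) : coeff0 (V j) = GQ.zero := by
  fin_cases j <;> decide +kernel

/-- **`u` has zero mean.** [ours] -/
theorem hasZeroMean_u : HasZeroMean u := by
  show ∫ x, u x = 0
  have i0 : Integrable (fun x => evalR (V 0) x • EuclideanSpace.single (0 : Fin 3) (1 : ℝ)) :=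
    ((isSmooth_evalR _).continuous.smul continuous_const).integrable_unitAddTorus
  have i1 : Integrable (fun x => evalR (V 1) x • EuclideanSpace.single (1 : Fin 3) (1 : ℝ)) :=
    ((isSmooth_evalR _).continuous.smul continuous_const).integrable_unitAddTorus
  have i2 : Integrable (fun x => evalR (V 2) x • EuclideanSpace.single (2 : Fin 3) (1 : ℝ)) :=
    ((isSmooth_evalR _).continuous.smul continuous_const).integrable_unitAddTorus
  have i01 : Integrable (fun x => evalR (V 0) x • EuclideanSpace.single (0 : Fin 3) (1 : ℝ) +
      evalR (V 1) x • EuclideanSpace.single (1 : Fin 3) (1 : ℝ)) := i0.add i1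
  unfold u tabField
  rw [integral_add i01 i2, integral_add i0 i1, integral_smul_const, integral_smul_const,
    integral_smul_const, integral_evalR, integral_evalR, integral_evalR, coeff0_V, coeff0_V, coeff0_V]
  simp [GQ.zero]

/-! ## 2. The heat direction `Δu` in table form -/

/-- `Δu = (2π)² · tabField (lapT ∘ V)`. [ours] -/
theorem laplacian_u : Torus.laplacian u = ((2 * Real.pi) ^ 2) • tabField (fun j => TP.lapT (V j)) := by
  funext x
  rw [Pi.smul_apply, laplacian_eq_sum_partialDeriv_partialDeriv isSmooth_u, Fin.sum_univ_three]
  ext j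
  simp only [PiLp.add_apply, PiLp.smul_apply, smul_eq_mul, tabField_apply, partialDeriv_partialDeriv_u,
    TP.lapT, evalR_append]
  ring

/-- `Δu` is smooth. [ours; bookkeeping] -/
theorem isSmooth_laplacian_u : IsSmooth (Torus.laplacian u) := isSmooth_u.laplacian

/-- Gradient of `Δu` in table form: `(∂ᵢΔu)ⱼ = (2π)³ · evalR (D i (lapT (V j)))`. [ours] -/
theorem partialDeriv_laplacian_u (i : Fin 3) (x : UnitAddTorus (Fin 3)) (j : Fin 3) :
    Torus.partialDeriv i (Torus.laplacian u) x j =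
      (2 * Real.pi) ^ 2 * (2 * Real.pi * evalR (TP.D i (TP.lapT (V j))) x) := by
  rw [laplacian_u, partialDeriv_const_smul ((isSmooth_tabField _).isContDiff (by simp)),
    Pi.smul_apply, partialDeriv_tabField]
  simp only [PiLp.smul_apply, smul_eq_mul, tabField_apply]

/-- `(∂₀Δu)₀ = 0`. [ours] -/
theorem partialDeriv_zero_laplacian_u_zero (x : UnitAddTorus (Fin 3)) :
    Torus.partialDeriv 0 (Torus.laplacian u) x 0 = 0 := by
  rw [partialDeriv_laplacian_u, V_zero, ← evalR_collect, collect_D_tables.2.2.1]; simp [evalR]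

/-- `(∂₁Δu)₀ = 0`. [ours] -/
theorem partialDeriv_one_laplacian_u_zero (x : UnitAddTorus (Fin 3)) :
    Torus.partialDeriv 1 (Torus.laplacian u) x 0 = 0 := by
  rw [partialDeriv_laplacian_u, V_zero, ← evalR_collect, collect_D_tables.2.2.2]; simp [evalR]

/-- `(∂ₖΔu)₁ = 0`. [ours] -/
theorem partialDeriv_laplacian_u_one (k : Fin 3) (x : UnitAddTorus (Fin 3)) :
    Torus.partialDeriv k (Torus.laplacian u) x 1 = 0 := by
  rw [partialDeriv_laplacian_u, V_one]; simp [TP.lapT, TP.D, evalR]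

/-- `(∂ₖΔu)₂ = 0`. [ours] -/
theorem partialDeriv_laplacian_u_two (k : Fin 3) (x : UnitAddTorus (Fin 3)) :
    Torus.partialDeriv k (Torus.laplacian u) x 2 = 0 := by
  rw [partialDeriv_laplacian_u, V_two]; simp [TP.lapT, TP.D, evalR]

/-! ## 3. Both strains are planar trace-free; the `(0,2)` entries -/

/-- `α = evalR (D 2 L0) = F′(x₂)/(2π)`. [ours; bookkeeping] -/
def α (x : UnitAddTorus (Fin 3)) : ℝ := evalR (TP.D 2 L0) x

/-- `β = evalR (D 2 (lapT L0)) = F‴(x₂)/(2π)³`. [ours; bookkeeping] -/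
def β (x : UnitAddTorus (Fin 3)) : ℝ := evalR (TP.D 2 (TP.lapT L0)) x

/-- **The strain of `u` is planar trace-free**, with `S₀₀ = 0` and `S₀₂ = π α`. [ours] -/
theorem strain_u (x : UnitAddTorus (Fin 3)) :
    IsPlanarTF (strainFlat u x) ∧ strainFlat u x (0, 0) = 0 ∧ strainFlat u x (0, 2) = Real.pi * α x := by
  refine ⟨⟨fun i j => strainFlat_symm u x i j, fun j => ?_, ?_⟩, ?_, ?_⟩
  · fin_cases j <;>
      simp [strainFlat_apply, partialDeriv_u_one, partialDeriv_one_u_zero, partialDeriv_u_two]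
  · simp [strainFlat_apply, partialDeriv_zero_u_zero, partialDeriv_u_two]
  · simp [strainFlat_apply, partialDeriv_zero_u_zero]
  · simp only [strainFlat_apply, partialDeriv_u_two, add_zero]
    rw [partialDeriv_u, V_zero, α]
    ring

/-- **The strain of `Δu` is planar trace-free**, with `S₀₀ = 0` and `S₀₂ = (2π)²π β`. [ours] -/
theorem strain_laplacian_u (x : UnitAddTorus (Fin 3)) :
    IsPlanarTF (strainFlat (Torus.laplacian u) x) ∧ strainFlat (Torus.laplacian u) x (0, 0) = 0 ∧
      strainFlat (Torus.laplacian u) x (0, 2) = (2 * Real.pi) ^ 2 * Real.pi * β x := by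
  refine ⟨⟨fun i j => strainFlat_symm _ x i j, fun j => ?_, ?_⟩, ?_, ?_⟩
  · fin_cases j <;>
      simp [strainFlat_apply, partialDeriv_laplacian_u_one, partialDeriv_one_laplacian_u_zero,
        partialDeriv_laplacian_u_two]
  · simp [strainFlat_apply, partialDeriv_zero_laplacian_u_zero, partialDeriv_laplacian_u_two]
  · simp [strainFlat_apply, partialDeriv_zero_laplacian_u_zero]
  · simp only [strainFlat_apply, partialDeriv_laplacian_u_two, add_zero]
    rw [partialDeriv_laplacian_u, V_zero, β]
    ring

/-- **Along the heat line the top-eigenvalue weight is an exact fourth power**: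
`λ(S(u + tΔu))⁴ = λ(−S(u + tΔu))⁴ = (π α + t (2π)²π β)⁴`. [ours] -/
theorem lam_pow_four_line (t : ℝ) (x : UnitAddTorus (Fin 3)) :
    lam (strainFlat (u + t • Torus.laplacian u) x) ^ 4 =
        (Real.pi * α x + t * ((2 * Real.pi) ^ 2 * Real.pi * β x)) ^ 4 ∧
      lam (-strainFlat (u + t • Torus.laplacian u) x) ^ 4 =
        (Real.pi * α x + t * ((2 * Real.pi) ^ 2 * Real.pi * β x)) ^ 4 ∧
      0 ≤ lam (strainFlat (u + t • Torus.laplacian u) x) ∧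
      0 ≤ lam (-strainFlat (u + t • Torus.laplacian u) x) := by
  obtain ⟨hu, hu00, hu02⟩ := strain_u x
  obtain ⟨hl, hl00, hl02⟩ := strain_laplacian_u x
  have hline := strainFlat_add_smul isContDiff_u (isSmooth_laplacian_u.isContDiff (by simp)) t x
  have hpl : IsPlanarTF (strainFlat (u + t • Torus.laplacian u) x) := by
    rw [hline]; exact hu.add_smul hl t
  have h00 : strainFlat (u + t • Torus.laplacian u) x (0, 0) = 0 := by
    rw [hline, PiLp.add_apply, PiLp.smul_apply, smul_eq_mul, hu00, hl00, mul_zero, add_zero]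
  have h02 : strainFlat (u + t • Torus.laplacian u) x (0, 2) =
      Real.pi * α x + t * ((2 * Real.pi) ^ 2 * Real.pi * β x) := by
    rw [hline, PiLp.add_apply, PiLp.smul_apply, smul_eq_mul, hu02, hl02]
  have hn : ‖strainFlat (u + t • Torus.laplacian u) x‖ ^ 2 =
      2 * (Real.pi * α x + t * ((2 * Real.pi) ^ 2 * Real.pi * β x)) ^ 2 := by
    rw [hpl.norm_sq_eq, h00, h02]; ring
  refine ⟨?_, ?_, ?_, ?_⟩
  · rw [hpl.lam_pow_four, hn]; ring
  · rw [hpl.lam_neg_pow_four, hn]; ring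
  · rw [hpl.lam_eq]; exact Real.sqrt_nonneg _
  · rw [hpl.neg.lam_eq]; exact Real.sqrt_nonneg _

end TopEigLaminate

end Summit.NavierStokesRegularity.FunctionalMining

end
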